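import Summits.ValiantsHypothesis.ValiantsHypothesis.Theorems.LacunarySymmetroidMatrixDescartesCensusDoorA34ConfluentNineWall
import Summits.ValiantsHypothesis.ValiantsHypothesis.Theorems.LacunarySymmetroidMatrixDescartesCensusDoorA34NineInertiaChamberIIUniqueDefinite

/-!
# `MatrixDescartes` census — DOOR A at `(3,4)`: THE CONFLUENT NINE, part 6 — transfer to an arbitrary positive definite bottom letter:
# for EVERY support off the walls `d₂ = 2d₁`, `2d₂ = 3d₁`, a ninefold positive root of a `(3,3)` row `S₀ + X^{d₁}S₁ + X^{d₂}S₂` with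
# `S₀ ≻ 0` and `S₁, S₂` symmetric is never a PSD-singular point (Claim L's own currency)

HONEST FRAMING.  Object-search cell `pub-symmetroid`, door-A seat `val-sym-door-p3` (g25); helper file beside the OPEN typed
statement `DoorA34 = PosRootLawAt 3 4 18` (route item `Theses.LacunarySymmetroid.DoorA34`, stmt-ValiantsHypothesis-19980),
asserted nowhere here.  Parts 1–5 (`…ConfluentNineKernel`, `…ConfluentNine`, `…ConfluentNineTable`, `…ConfluentNineNewton`,
`…ConfluentNineWall`) work in the congruence gauge `S₀ = 1`; this part performs the congruence `S₀ = YᵀY`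
(`NineInertia.exists_transpose_mul_self_of_posDef`) at the level of the determinant POLYNOMIAL (`det_pencil_congr`: the pencil
determinant of `(S₀, S₁, S₂)` is `C (det Y)²` times that of `(1, Y⁻ᵀS₁Y⁻¹, Y⁻ᵀS₂Y⁻¹)`), so that ninefold roots and positive
semidefiniteness transfer, and states the coalesced corner of Claim L for a general positive definite bottom letter:
**`not_posSemidef_of_ninefold_root_posDef`**.  Finally `three_point_relation` (codimension-two confluence: an `(N+2)`-term fewnomial with an
`N`-fold root has coefficients on the pencil `(α + βe)/∏(e − e')`) is the entry point for the EIGHTFOLD family (next rung of «capacity =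
contact order + 1»).  Nothing here bounds `ζ_sym(3,3)` or `ζ_sym(3,4)` («no 9-fold contact does not by
itself bound the count»); `DoorA34`, Claim L on `d₂ < 2d₁` and `MatrixDescartes` (stmt-ValiantsHypothesis-18050) stay OPEN; registers
unchanged; nothing on `VP ≠ VNP`.
[folklore] congruence invariance of the determinant up to a square and of semidefiniteness; `Polynomial.funext`.
-/

-- `Summit.ValiantsHypothesis.ValiantsHypothesis.…` repeats a component by the D-0017 layout
-- (single-conjunct summit), which the `dupNamespace` linter flags; the name is mandated.
set_option linter.dupNamespace false

namespace Summit.ValiantsHypothesis.ValiantsHypothesis.Theorems.LacunarySymmetroidMatrixDescartes.Census.ConfluentNine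

open Polynomial Finset
open scoped BigOperators Matrix

/-! ## 9. Congruence at the level of the pencil determinant -/

/-- Evaluation of the three-letter pencil `(S₀, S₁, S₂)` on `(0, d₁, d₂)` at a real point. [folklore] -/
theorem eval_pencil_three (d₁ d₂ : ℕ) (S₀ S₁ S₂ : Matrix (Fin 3) (Fin 3) ℝ) (t : ℝ) :
    (∑ l, t ^ (![0, d₁, d₂] : Fin 3 → ℕ) l • (![S₀, S₁, S₂] : Fin 3 → Matrix (Fin 3) (Fin 3) ℝ) l)
      = S₀ + t ^ d₁ • S₁ + t ^ d₂ • S₂ := by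
  simp [Fin.sum_univ_three, add_assoc]

/-- **Congruence of the pencil determinant.**  If `S₀ = YᵀY` with `Y` invertible, then as POLYNOMIALS
`det(S₀ + X^{d₁}S₁ + X^{d₂}S₂) = C (det Y)² · det(1 + X^{d₁}(Y⁻ᵀS₁Y⁻¹) + X^{d₂}(Y⁻ᵀS₂Y⁻¹))`. [folklore] -/
theorem det_pencil_congr (d₁ d₂ : ℕ) (S₀ S₁ S₂ Y : Matrix (Fin 3) (Fin 3) ℝ) (hYdet : Y.det ≠ 0) (hY : S₀ = Yᵀ * Y) :
    (∑ l, (X : ℝ[X]) ^ (![0, d₁, d₂] : Fin 3 → ℕ) l • ((![S₀, S₁, S₂] : Fin 3 → Matrix (Fin 3) (Fin 3) ℝ) l).map C).det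
      = C (Y.det ^ 2) *
        (∑ l, (X : ℝ[X]) ^ (![0, d₁, d₂] : Fin 3 → ℕ) l •
          ((![1, (Y⁻¹)ᵀ * S₁ * Y⁻¹, (Y⁻¹)ᵀ * S₂ * Y⁻¹] : Fin 3 → Matrix (Fin 3) (Fin 3) ℝ) l).map C).det := by
  have hYu : IsUnit Y.det := isUnit_iff_ne_zero.mpr hYdet
  have hZY : Y⁻¹ * Y = 1 := Matrix.nonsing_inv_mul Y hYu
  apply Polynomial.funext
  intro t
  rw [eval_mul, eval_C, SymmetroidDescartes.eval_det_pencil, SymmetroidDescartes.eval_det_pencil, eval_pencil_three,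
    eval_pencil_three]
  have h1 : Yᵀ * ((Y⁻¹)ᵀ * S₁ * Y⁻¹) * Y = S₁ := by
    rw [show Yᵀ * ((Y⁻¹)ᵀ * S₁ * Y⁻¹) * Y = (Y⁻¹ * Y)ᵀ * S₁ * (Y⁻¹ * Y) by
      rw [Matrix.transpose_mul]; simp only [Matrix.mul_assoc]]
    rw [hZY, Matrix.transpose_one, Matrix.one_mul, Matrix.mul_one]
  have h2 : Yᵀ * ((Y⁻¹)ᵀ * S₂ * Y⁻¹) * Y = S₂ := by
    rw [show Yᵀ * ((Y⁻¹)ᵀ * S₂ * Y⁻¹) * Y = (Y⁻¹ * Y)ᵀ * S₂ * (Y⁻¹ * Y) by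
      rw [Matrix.transpose_mul]; simp only [Matrix.mul_assoc]]
    rw [hZY, Matrix.transpose_one, Matrix.one_mul, Matrix.mul_one]
  have e : S₀ + t ^ d₁ • S₁ + t ^ d₂ • S₂
      = Yᵀ * (1 + t ^ d₁ • ((Y⁻¹)ᵀ * S₁ * Y⁻¹) + t ^ d₂ • ((Y⁻¹)ᵀ * S₂ * Y⁻¹)) * Y := by
    rw [Matrix.mul_add, Matrix.mul_add, Matrix.add_mul, Matrix.add_mul, Matrix.mul_one, ← hY, Matrix.mul_smul, Matrix.smul_mul,
      Matrix.mul_smul, Matrix.smul_mul, h1, h2]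
  rw [e, Matrix.det_mul, Matrix.det_mul, Matrix.det_transpose]
  ring

/-! ## 10. The coalesced corner of Claim L for a general positive definite bottom letter -/

/-- **THE COALESCED CORNER OF CLAIM L (positive definite bottom letter, ALL supports off two walls).**  Let `S₀ ≻ 0` and `S₁, S₂` be real
symmetric `3 × 3` letters, `0 < d₁ < d₂` with `d₂ ≠ 2d₁` and `2d₂ ≠ 3d₁`, and suppose `(X − x₀)⁹ ∣ det(S₀ + X^{d₁}S₁ + X^{d₂}S₂)` for some
real `x₀`.  Then `S₀ + x₀^{d₁}S₁ + x₀^{d₂}S₂` is NOT positive semidefinite: a ninefold positive root of a definite-bottom `(3,3)` row is never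
a coalescence of nine PSD-singular (`λ_min`-) points — in the chambers `d₂ > 2d₁` and `3d₁ < 2d₂ < 4d₁` such a row has no ninefold root at
all, in chamber IV `2d₂ < 3d₁` the coalesced nine is a pseudoline contact (parts 2, 5; congruence `S₀ = YᵀY`). [folklore] -/
theorem not_posSemidef_of_ninefold_root_posDef (d₁ d₂ : ℕ) (S₀ S₁ S₂ : Matrix (Fin 3) (Fin 3) ℝ) (hS₀ : S₀.PosDef)
    (hS₁ : S₁.IsSymm) (hS₂ : S₂.IsSymm) (h0 : 0 < d₁) (h01 : d₁ < d₂) (hw2 : d₂ ≠ 2 * d₁) (hw32 : 2 * d₂ ≠ 3 * d₁) (x₀ : ℝ)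
    (h9 : (X - C x₀) ^ 9 ∣
      (∑ l, (X : ℝ[X]) ^ (![0, d₁, d₂] : Fin 3 → ℕ) l • ((![S₀, S₁, S₂] : Fin 3 → Matrix (Fin 3) (Fin 3) ℝ) l).map C).det) :
    ¬ (S₀ + x₀ ^ d₁ • S₁ + x₀ ^ d₂ • S₂).PosSemidef := by
  obtain ⟨Y, hYdet, hY⟩ := NineInertia.exists_transpose_mul_self_of_posDef hS₀
  have hYu : IsUnit Y.det := isUnit_iff_ne_zero.mpr hYdet
  have hsymm : ∀ S : Matrix (Fin 3) (Fin 3) ℝ, S.IsSymm → ((Y⁻¹)ᵀ * S * Y⁻¹).IsSymm := fun S hS => by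
    unfold Matrix.IsSymm
    rw [Matrix.transpose_mul, Matrix.transpose_mul, Matrix.transpose_transpose, hS.eq, Matrix.mul_assoc]
  rw [det_pencil_congr d₁ d₂ S₀ S₁ S₂ Y hYdet hY] at h9
  have hunit : IsUnit (C (Y.det ^ 2)) := Polynomial.isUnit_C.mpr (IsUnit.pow 2 hYu)
  rw [IsUnit.dvd_mul_left hunit] at h9
  have hnot := not_posSemidef_of_ninefold_root_offwalls d₁ d₂ ((Y⁻¹)ᵀ * S₁ * Y⁻¹) ((Y⁻¹)ᵀ * S₂ * Y⁻¹) h0 h01 hw2 hw32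
    (hsymm S₁ hS₁) (hsymm S₂ hS₂) x₀ h9
  intro hP
  apply hnot
  have h1 : (Y⁻¹)ᵀ * (Yᵀ * Y) * Y⁻¹ = 1 := by
    rw [show (Y⁻¹)ᵀ * (Yᵀ * Y) * Y⁻¹ = (Y * Y⁻¹)ᵀ * (Y * Y⁻¹) by rw [Matrix.transpose_mul]; simp only [Matrix.mul_assoc]]
    rw [Matrix.mul_nonsing_inv Y hYu, Matrix.transpose_one, Matrix.one_mul]
  have e : 1 + x₀ ^ d₁ • ((Y⁻¹)ᵀ * S₁ * Y⁻¹) + x₀ ^ d₂ • ((Y⁻¹)ᵀ * S₂ * Y⁻¹) = (Y⁻¹)ᴴ * (S₀ + x₀ ^ d₁ • S₁ + x₀ ^ d₂ • S₂) * Y⁻¹ := by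
    rw [Matrix.conjTranspose_eq_transpose_of_trivial, Matrix.mul_add, Matrix.mul_add, Matrix.add_mul, Matrix.add_mul, hY,
      Matrix.mul_smul, Matrix.smul_mul, Matrix.mul_smul, Matrix.smul_mul, h1]
  rw [e]
  exact hP.conjTranspose_mul_mul_same (Y⁻¹)

/-! ## 11. Toward the next rung: the three-point relation (codimension-two confluence, e.g. an EIGHTFOLD root) -/

/-- **Three-point confluence relation.**  If `(X − 1)^N ∣ ∑_{i ∈ s} cᵢ X^{nᵢ}` with `#s ≤ N + 2`, then for any three distinct indices
`i, j, k` of `s`, with `π_x := ∏_{l ∈ s ∖ {i,j,k}} (n_x − n_l)`:  `c_i π_i + c_j π_j + c_k π_k = 0` (test polynomial `∏_{l ∉ {i,j,k}}(X − n_l)`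
of degree `#s − 3 < N`).  With distinct exponents this says that the coefficient vector of an `(N+2)`-term fewnomial with an `N`-fold root
lies on the explicit PENCIL `c_e = (α + β·e)/∏_{e' ≠ e}(e − e')` — the eightfold family of a `(3,3)` row is the case `N = 8`. [folklore] -/
theorem three_point_relation {ι : Type*} [DecidableEq ι] (s : Finset ι) (c : ι → ℝ) (n : ι → ℕ) {N : ℕ}
    (h : (X - C 1) ^ N ∣ ∑ i ∈ s, C (c i) * X ^ n i) (hcard : s.card ≤ N + 2)
    {i j k : ι} (hi : i ∈ s) (hj : j ∈ s) (hk : k ∈ s) (hij : i ≠ j) (hik : i ≠ k) (hjk : j ≠ k) :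
    c i * ∏ l ∈ ((s.erase i).erase j).erase k, ((n i : ℝ) - n l)
      + c j * ∏ l ∈ ((s.erase i).erase j).erase k, ((n j : ℝ) - n l)
      + c k * ∏ l ∈ ((s.erase i).erase j).erase k, ((n k : ℝ) - n l) = 0 := by
  set T : Finset ι := ((s.erase i).erase j).erase k with hT
  set g : ℝ[X] := ∏ l ∈ T, (X - C (n l : ℝ)) with hg
  have hj' : j ∈ s.erase i := Finset.mem_erase.mpr ⟨hij.symm, hj⟩
  have hk' : k ∈ (s.erase i).erase j := Finset.mem_erase.mpr ⟨hjk.symm, Finset.mem_erase.mpr ⟨hik.symm, hk⟩⟩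
  have hcardT : T.card + 3 = s.card := by
    rw [hT, Finset.card_erase_of_mem hk', Finset.card_erase_of_mem hj', Finset.card_erase_of_mem hi]
    have h3 : 3 ≤ s.card := by
      calc 3 = ({i, j, k} : Finset ι).card := by
            rw [Finset.card_insert_of_notMem (by simp [hij, hik]), Finset.card_pair hjk]
        _ ≤ s.card := Finset.card_le_card (by
            intro x hx
            simp only [Finset.mem_insert, Finset.mem_singleton] at hx
            rcases hx with rfl | rfl | rfl
            · exact hi
            · exact hj
            · exact hk)
    omega
  have hdeg : g.natDegree < N := by
    calc g.natDegree ≤ ∑ l ∈ T, (X - C (n l : ℝ)).natDegree := natDegree_prod_le _ _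
      _ ≤ ∑ l ∈ T, 1 :=
          Finset.sum_le_sum (f := fun l => (X - C (n l : ℝ)).natDegree) (g := fun _ => 1) fun l _ => natDegree_X_sub_C_le (n l : ℝ)
      _ = T.card := by simp
      _ < N := by omega
  have hsum := sum_mul_eval_eq_zero s c n h g hdeg
  have hvan : ∀ l ∈ T, c l * g.eval (n l : ℝ) = 0 := by
    intro l hl
    rw [hg, eval_prod, Finset.prod_eq_zero hl (by simp), mul_zero]
  rw [← Finset.add_sum_erase _ _ hi, ← Finset.add_sum_erase _ _ hj', ← Finset.add_sum_erase _ _ hk', Finset.sum_eq_zero hvan,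
    add_zero] at hsum
  have ev : ∀ x : ι, g.eval (n x : ℝ) = ∏ l ∈ T, ((n x : ℝ) - n l) := fun x => by rw [hg, eval_prod]; simp
  rw [ev, ev, ev] at hsum
  linear_combination hsum

end Summit.ValiantsHypothesis.ValiantsHypothesis.Theorems.LacunarySymmetroidMatrixDescartes.Census.ConfluentNine
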